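import Summits.BirchSwinnertonDyer.BirchSwinnertonDyer.Theorems.KolyvaginRankRigidityAtTwoRegularRefillAtRegularStep
import HarnessLib

/-!
# Crux U1 `KolyvaginBoundedDefectAtTwo` (stmt-BirchSwinnertonDyer-28083), LINE 17 `regular_core_rigidity` v3,
# stub S1b `stub_nearCoreExistenceAtTwo` — ONE STEP OF THE WALK, LOCAL CONSEQUENCES I: survivors and the cut
# inequality

Width seat `bsd-line-krr2-p2` g14 (ONE READER on S1b); `--supports stmt-BirchSwinnertonDyer-28083` (helper). THEOREMS
ONLY; nothing here proves S1b, U1, a rung or BSD. BSD is NOT proved.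

## Setting (g13's, `…RegularRefillAtRegularStep` / `…RegularRefillHybridStructure`)
`𝓛 = 𝓕(c) = selmerF W 2^k 𝒯 (placesDividing K c)` for a square-free Kolyvagin conductor `c` (indices `≥ k+1`) and a
place `v ∣ ℓ ∣ c`; `S = H¹_{𝓛[v ↦ Kum_v]}` (the previous vertex of the walk), `S' = H¹_{𝓛}` (the new vertex),
`Rel = H¹_{𝓛[v ↦ ⊤]}`, `A = loc_v(S)`, `X = loc_v(Rel)` with `#X = #Kum_v` (g13, p674377).
* `mem_selmerF_of_localization_eq_zero` / `mem_update_kummer_of_localization_eq_zero` — SURVIVORS: a class of either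
  vertex with `loc_v = 0` lies in the other (the two structures agree off `v`);
* **`natCard_selmerF_mul_sq_le`** — THE CUT INEQUALITY `#S' · #A² ≤ #S · #Kum_v`: both vertices contain
  `S₀ = Rel ∩ ker loc_v`, `#S = #S₀·#A`, `#S' = #S₀·#loc_v(S')`, and `A ⊕ loc_v(S') ↪ X` (`Kum_v ∩ 𝒯_v = 0`, JET's
  `card_map_mul_card_map_le`). With the refill law (`…WalkStepRefill`, `#S·#Kum_v ≤ 2^(4j+4)·#A²·#S'`) the size of the
  new vertex is pinned to `#S·#Kum_v/#A²` up to a factor independent of `k` — the bookkeeping of the regular-prime walk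
  (Mazur–Rubin Prop. 4.1.5 ⇒ Cor. 2.7.3 transplanted to `p = 2` along regular primes).
References (locators only; no cited FACT is declared): [cite: MazurRubin2004, Prop. 1.3.2, Thm. 2.3.4, §4.1]
[cite: Jetchev2008, Lemma 5.2, proof of Prop. 5.3].
Design: no definitions; `K : Type`; axioms `propext`, `Classical.choice`, `Quot.sound`.
-/

set_option autoImplicit false
-- the Theorems namespace of this sub repeats the summit name by design (D-0017 nested layout)
set_option linter.dupNamespace false

noncomputable section

open scoped Classical
open Function NumberField IsDedekindDomain WeierstrassCurve Field
open Literature.NumberTheory.EllipticCurves Literature.NumberTheory.EllipticCurves.Jetchev2008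
open Literature.NumberTheory.GaloisRepresentations Literature.NumberTheory.GaloisCohomology
open Literature.NumberTheory.GaloisRepresentations.DiscreteGaloisModule (localTatePairingZMod tateDual
  transverseSubgroup SelmerStructure)
open Literature.NumberTheory.Automorphic
open Summit.BirchSwinnertonDyer.Rank1Residual
open Summit.BirchSwinnertonDyer.Rank1Residual.JET.RingClassTransverse
open Summit.BirchSwinnertonDyer.Rank1Residual.JET.SelmerVocabulary
open Summit.BirchSwinnertonDyer.Rank1Residual.X11b.Relaxation (invWeilPairing invWeilPairing_apply
  invWeilPairing_eq_zero_of_mem)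
open Summit.BirchSwinnertonDyer.BirchSwinnertonDyer.Theorems.KolyvaginLowerBoundAtTwo
open Summit.BirchSwinnertonDyer.Rank1Residual.JET.Section6 (card_eq_card_inf_ker_mul_card_map card_map_mul_card_map_le)

namespace Summit.BirchSwinnertonDyer.BirchSwinnertonDyer.Theorems.KolyvaginAtTwo.RegularRefill

variable {K : Type} [Field K] [NumberField K] (W : WeierstrassCurve ℚ) [W.IsElliptic] [W.IsGloballyMinimal]
  (k : ℕ)
  (e : geomTorsion (W.baseChange K) ((2 ^ k : ℕ) : ℤ) → geomTorsion (W.baseChange K) ((2 ^ k : ℕ) : ℤ) →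
    AlgebraicClosure K)
  (hμ : ∀ S T, e S T ^ (2 ^ k) = 1)
  (hadd₁ : ∀ S₁ S₂ T, e (S₁ + S₂) T = e S₁ T * e S₂ T)
  (hadd₂ : ∀ S T₁ T₂, e S (T₁ + T₂) = e S T₁ * e S T₂)
  (hgal : ∀ (g : absoluteGaloisGroup K) (S T : geomTorsion (W.baseChange K) ((2 ^ k : ℕ) : ℤ)),
    g • e S T = e (g • S) (g • T))
  (halt : ∀ T, e T T = 1) (hnondeg : ∀ T, (∀ S, e S T = 1) → T = 0)
  (inv : LocalInvariants K (2 ^ k))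
  (hK : IsImaginaryQuadratic K) (hD : NumberField.discr K < -4) (ι : K →+* ℂ)
  [∀ j : ℕ, NumberField (ringClassField K ι j)] (hk : 1 ≤ k)
  (c : ℕ) (hc : Squarefree c)
  (hkol : ∀ ℓ ∈ c.primeFactors, Zhang2014.IsKolyvaginPrime (W.conductorNorm ℤ) W K 2 ℓ)
  (hkM : ∀ ℓ ∈ c.primeFactors, k + 1 ≤ Zhang2014.kolyvaginIndex W 2 ℓ)
  (𝒯 : SelmerStructure ((W.baseChange K).torsionGaloisModule ((2 ^ k : ℕ) : ℤ)))
  (h𝒯 : ∀ v : HeightOneSpectrum (𝓞 K), 𝒯 (Sum.inr v) =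
    ⨅ ℓ ∈ c.primeFactors.filter (fun ℓ : ℕ ↦ ((ℓ : ℕ) : 𝓞 K) ∈ v.asIdeal),
      ⨅ (w' : HeightOneSpectrum (𝓞 (ringClassField K ι ℓ))) (_ : w'.asIdeal.LiesOver v.asIdeal),
        letI := (adicCompletionOfLiesOver K (ringClassField K ι ℓ) v w').toAlgebra
        transverseSubgroup (GaloisRep.toLocal v ((W.baseChange K).torsionGaloisModule ((2 ^ k : ℕ) : ℤ)))
          (w'.adicCompletion (ringClassField K ι ℓ)))
  (hperf : inv.IsPerfect) (hvan : inv.SumLocalTermEqZero) (hcomp : inv.SelmerComplement)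
  {ℓ : ℕ} (hℓc : ℓ ∈ c.primeFactors)
  (hreg : ∃ (v₁ : HeightOneSpectrum (𝓞 ℚ)) (𝔓₁ : Ideal (absIntegers (𝓞 ℚ) ℚ)) (h : absoluteGaloisGroup ℚ),
    (ℓ : 𝓞 ℚ) ∈ v₁.asIdeal ∧ 𝔓₁ ∈ v₁.primesAbove ∧ IsArithFrobAt (𝓞 ℚ) h 𝔓₁ ∧
    (∀ X : geomTorsion W ((2 ^ k : ℕ) : ℤ), h • h • X = X) ∧
    ∃ P : geomTorsion W ((2 ^ k : ℕ) : ℤ), (2 : ℤ) ^ (k - 1) • (P + h • P) ≠ 0)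
  (v : HeightOneSpectrum (𝓞 K)) (hv : (ℓ : 𝓞 K) ∈ v.asIdeal)
  {τ : K ≃ₐ[ℚ] K} (hτ1 : τ ≠ 1) (hfix : τ • v = v) {s : ℤ} (hs : s = 1 ∨ s = -1)

/-! ### §1 Survivors and the cut inequality -/

omit [W.IsElliptic] [W.IsGloballyMinimal] in
/-- **SURVIVORS.** A class of the previous vertex `H¹_{𝓛[v ↦ Kum_v]}` whose localisation at `v` vanishes lies in the new
vertex `H¹_{𝓛}` (the two structures agree off `v`, and `0 ∈ 𝒯_v`). [cite: Jetchev2008, §3.4.1] [cite: MazurRubin2004, §4.1] -/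
theorem mem_selmerF_of_localization_eq_zero (hvc : v ∈ placesDividing K c)
    {x : galoisCohomology ((W.baseChange K).torsionGaloisModule ((2 ^ k : ℕ) : ℤ)) 1}
    (hx : x ∈ SelmerStructure.selmerGroup (Function.update (selmerF W ((2 ^ k : ℕ) : ℤ) 𝒯 (placesDividing K c))
      (Sum.inr v : Place K) ((W.baseChange K).kummerSelmerStructure ((2 ^ k : ℕ) : ℤ) (Sum.inr v : Place K)) :
      SelmerStructure ((W.baseChange K).torsionGaloisModule ((2 ^ k : ℕ) : ℤ))))
    (h0 : galoisCohomology.localization ((W.baseChange K).torsionGaloisModule ((2 ^ k : ℕ) : ℤ)) (Sum.inr v : Place K) 1 x = 0) :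
    x ∈ (selmerF W ((2 ^ k : ℕ) : ℤ) 𝒯 (placesDividing K c)).selmerGroup := by
  set 𝓛 := selmerF W ((2 ^ k : ℕ) : ℤ) 𝒯 (placesDividing K c) with h𝓛
  rw [selmerGroup_update_eq_inf_comap W k 𝓛 v] at hx
  have h𝓛v : 𝓛 (Sum.inr v) = 𝒯 (Sum.inr v) := by rw [h𝓛, selmerF_inr, if_pos hvc]
  have hS' : 𝓛.selmerGroup = SelmerStructure.selmerGroup (Function.update 𝓛 (Sum.inr v : Place K) ⊤ :
      SelmerStructure ((W.baseChange K).torsionGaloisModule ((2 ^ k : ℕ) : ℤ))) ⊓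
      (𝒯 (Sum.inr v)).comap (galoisCohomology.localization ((W.baseChange K).torsionGaloisModule ((2 ^ k : ℕ) : ℤ))
        (Sum.inr v : Place K) 1) := by
    have h := selmerGroup_update_eq_inf_comap W k 𝓛 v (𝒯 (Sum.inr v))
    have hupd : Function.update 𝓛 (Sum.inr v : Place K) (𝒯 (Sum.inr v)) = 𝓛 := by
      rw [← h𝓛v, Function.update_eq_self]
    rw [hupd] at h
    exact h
  rw [hS']
  refine AddSubgroup.mem_inf.mpr ⟨(AddSubgroup.mem_inf.mp hx).1, ?_⟩
  rw [AddSubgroup.mem_comap, h0]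
  exact AddSubgroup.zero_mem _

omit [W.IsElliptic] [W.IsGloballyMinimal] in
/-- **SURVIVORS, converse direction.** A class of the new vertex `H¹_{𝓛}` whose localisation at `v` vanishes lies in the
previous vertex `H¹_{𝓛[v ↦ Kum_v]}`. [cite: Jetchev2008, §3.4.1] -/
theorem mem_update_kummer_of_localization_eq_zero (hvc : v ∈ placesDividing K c)
    {x : galoisCohomology ((W.baseChange K).torsionGaloisModule ((2 ^ k : ℕ) : ℤ)) 1}
    (hx : x ∈ (selmerF W ((2 ^ k : ℕ) : ℤ) 𝒯 (placesDividing K c)).selmerGroup)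
    (h0 : galoisCohomology.localization ((W.baseChange K).torsionGaloisModule ((2 ^ k : ℕ) : ℤ)) (Sum.inr v : Place K) 1 x = 0) :
    x ∈ SelmerStructure.selmerGroup (Function.update (selmerF W ((2 ^ k : ℕ) : ℤ) 𝒯 (placesDividing K c))
      (Sum.inr v : Place K) ((W.baseChange K).kummerSelmerStructure ((2 ^ k : ℕ) : ℤ) (Sum.inr v : Place K)) :
      SelmerStructure ((W.baseChange K).torsionGaloisModule ((2 ^ k : ℕ) : ℤ))) := by
  set 𝓛 := selmerF W ((2 ^ k : ℕ) : ℤ) 𝒯 (placesDividing K c) with h𝓛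
  have h𝓛v : 𝓛 (Sum.inr v) = 𝒯 (Sum.inr v) := by rw [h𝓛, selmerF_inr, if_pos hvc]
  have hS' : 𝓛.selmerGroup = SelmerStructure.selmerGroup (Function.update 𝓛 (Sum.inr v : Place K) ⊤ :
      SelmerStructure ((W.baseChange K).torsionGaloisModule ((2 ^ k : ℕ) : ℤ))) ⊓
      (𝒯 (Sum.inr v)).comap (galoisCohomology.localization ((W.baseChange K).torsionGaloisModule ((2 ^ k : ℕ) : ℤ))
        (Sum.inr v : Place K) 1) := by
    have h := selmerGroup_update_eq_inf_comap W k 𝓛 v (𝒯 (Sum.inr v))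
    have hupd : Function.update 𝓛 (Sum.inr v : Place K) (𝒯 (Sum.inr v)) = 𝓛 := by
      rw [← h𝓛v, Function.update_eq_self]
    rw [hupd] at h
    exact h
  rw [hS'] at hx
  rw [selmerGroup_update_eq_inf_comap W k 𝓛 v]
  refine AddSubgroup.mem_inf.mpr ⟨(AddSubgroup.mem_inf.mp hx).1, ?_⟩
  rw [AddSubgroup.mem_comap, h0]
  exact AddSubgroup.zero_mem _

include hμ hadd₁ hadd₂ hgal hK hD hk hc hkol hkM h𝒯 halt hnondeg hperf hvan hcomp in
/-- **THE CUT INEQUALITY `#S' · #A² ≤ #S · #Kum_v`** (`S = H¹_{𝓛[v ↦ Kum_v]}`, `S' = H¹_{𝓛}`, `A = loc_v(S)`): both vertices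
contain the `v`-strict group `S₀ = Rel ∩ ker loc_v`, `#S = #S₀ · #A`, `#S' = #S₀ · #loc_v(S')`, and
`A ⊕ loc_v(S') ↪ X = loc_v(Rel)` (`Kum_v ∩ 𝒯_v = 0`) with `#X = #Kum_v`. [cite: Jetchev2008, Lemma 5.2 (ii)–(iv)]
[cite: MazurRubin2004, Thm. 2.3.4, §4.1] -/
theorem natCard_selmerF_mul_sq_le [NeZero (2 ^ k)] [Finite (geomTorsion (W.baseChange K) ((2 ^ k : ℕ) : ℤ))]
    (hvc : v ∈ placesDividing K c) :
    Nat.card (selmerF W ((2 ^ k : ℕ) : ℤ) 𝒯 (placesDividing K c)).selmerGroup *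
        Nat.card ((SelmerStructure.selmerGroup (Function.update (selmerF W ((2 ^ k : ℕ) : ℤ) 𝒯 (placesDividing K c))
            (Sum.inr v : Place K) ((W.baseChange K).kummerSelmerStructure ((2 ^ k : ℕ) : ℤ) (Sum.inr v : Place K)) :
            SelmerStructure ((W.baseChange K).torsionGaloisModule ((2 ^ k : ℕ) : ℤ)))).map
          (galoisCohomology.localization ((W.baseChange K).torsionGaloisModule ((2 ^ k : ℕ) : ℤ))
            (Sum.inr v : Place K) 1)) ^ 2 ≤
      Nat.card (SelmerStructure.selmerGroup (Function.update (selmerF W ((2 ^ k : ℕ) : ℤ) 𝒯 (placesDividing K c))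
          (Sum.inr v : Place K) ((W.baseChange K).kummerSelmerStructure ((2 ^ k : ℕ) : ℤ) (Sum.inr v : Place K)) :
          SelmerStructure ((W.baseChange K).torsionGaloisModule ((2 ^ k : ℕ) : ℤ)))) *
        Nat.card ((W.baseChange K).kummerSelmerStructure ((2 ^ k : ℕ) : ℤ) (Sum.inr v : Place K)) := by
  haveI : Finite (galoisCohomology ((((W.baseChange K).torsionGaloisModule ((2 ^ k : ℕ) : ℤ))).toLocal
      (Sum.inr v : Place K)) 1) := finite_galoisCohomology_one_toLocal _ v
  set 𝓛 := selmerF W ((2 ^ k : ℕ) : ℤ) 𝒯 (placesDividing K c) with h𝓛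
  set loc := galoisCohomology.localization ((W.baseChange K).torsionGaloisModule ((2 ^ k : ℕ) : ℤ))
    (Sum.inr v : Place K) 1 with hloc
  set Kum := (W.baseChange K).kummerSelmerStructure ((2 ^ k : ℕ) : ℤ) (Sum.inr v : Place K) with hKum
  set Rel := SelmerStructure.selmerGroup (Function.update 𝓛 (Sum.inr v : Place K) ⊤ :
    SelmerStructure ((W.baseChange K).torsionGaloisModule ((2 ^ k : ℕ) : ℤ))) with hRel
  have hS : SelmerStructure.selmerGroup (Function.update 𝓛 (Sum.inr v : Place K) Kum :
        SelmerStructure ((W.baseChange K).torsionGaloisModule ((2 ^ k : ℕ) : ℤ))) = Rel ⊓ Kum.comap loc :=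
    selmerGroup_update_eq_inf_comap W k 𝓛 v _
  have h𝓛v : 𝓛 (Sum.inr v) = 𝒯 (Sum.inr v) := by rw [h𝓛, selmerF_inr, if_pos hvc]
  have hS' : 𝓛.selmerGroup = Rel ⊓ (𝒯 (Sum.inr v)).comap loc := by
    have h := selmerGroup_update_eq_inf_comap W k 𝓛 v (𝒯 (Sum.inr v))
    have hupd : Function.update 𝓛 (Sum.inr v : Place K) (𝒯 (Sum.inr v)) = 𝓛 := by
      rw [← h𝓛v, Function.update_eq_self]
    rw [hupd] at h
    exact h
  rw [hS, hS']
  set S : AddSubgroup _ := Rel ⊓ Kum.comap loc with hSdef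
  set S' : AddSubgroup _ := Rel ⊓ (𝒯 (Sum.inr v)).comap loc with hS'def
  -- common kernel
  have hker : S ⊓ loc.ker = S' ⊓ loc.ker := by
    ext z
    simp only [hSdef, hS'def, AddSubgroup.mem_inf, AddSubgroup.mem_comap, AddMonoidHom.mem_ker]
    constructor
    · rintro ⟨⟨hz, -⟩, h0⟩; exact ⟨⟨hz, by rw [h0]; exact AddSubgroup.zero_mem _⟩, h0⟩
    · rintro ⟨⟨hz, -⟩, h0⟩; exact ⟨⟨hz, by rw [h0]; exact AddSubgroup.zero_mem _⟩, h0⟩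
  have hSc : Nat.card S = Nat.card ↥(S ⊓ loc.ker) * Nat.card (S.map loc) := card_eq_card_inf_ker_mul_card_map loc S
  have hS'c : Nat.card S' = Nat.card ↥(S' ⊓ loc.ker) * Nat.card (S'.map loc) := card_eq_card_inf_ker_mul_card_map loc S'
  -- `A ⊕ B ↪ X`
  have hdisj : Disjoint Kum (𝒯 (Sum.inr v)) :=
    disjoint_iff.mpr (kummer_inf_transverse_eq_bot_two W k hK hD ι hk c hc hkol hkM 𝒯 h𝒯 v hvc)
  have hAB : Nat.card (S.map loc) * Nat.card (S'.map loc) ≤ Nat.card (Rel.map loc) :=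
    card_map_mul_card_map_le loc inf_le_left inf_le_left hdisj
      (by rintro _ ⟨z, hz, rfl⟩; exact AddSubgroup.mem_comap.mp (AddSubgroup.mem_inf.mp hz).2)
      (by rintro _ ⟨z, hz, rfl⟩; exact AddSubgroup.mem_comap.mp (AddSubgroup.mem_inf.mp hz).2)
  have hX : Nat.card (Rel.map loc) = Nat.card Kum :=
    natCard_map_localization_relaxed_selmerF_eq W k e hμ hadd₁ hadd₂ hgal halt hnondeg inv hK hD ι hk c hc hkol hkM 𝒯
      h𝒯 hperf hvan hcomp v hvc
  calc Nat.card S' * Nat.card (S.map loc) ^ 2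
      = Nat.card ↥(S' ⊓ loc.ker) * Nat.card (S.map loc) * (Nat.card (S.map loc) * Nat.card (S'.map loc)) := by
        rw [hS'c]; ring
    _ ≤ Nat.card ↥(S' ⊓ loc.ker) * Nat.card (S.map loc) * Nat.card (Rel.map loc) := Nat.mul_le_mul_left _ hAB
    _ = Nat.card S * Nat.card Kum := by rw [hX, hSc, hker]

end Summit.BirchSwinnertonDyer.BirchSwinnertonDyer.Theorems.KolyvaginAtTwo.RegularRefill

end
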